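import Summits.QuantumAdvantage.AdviceFreeQNC0.WalkTubeRank
import Summits.QuantumAdvantage.AdviceFreeQNC0.WalkTubeMass
import Summits.QuantumAdvantage.AdviceFreeQNC0.BinomialTailLower
import Summits.QuantumAdvantage.AdviceFreeQNC0.WalkTransport
import HarnessLib

/-!
# Cell qa-qnc0 (route `DWalkThree`, face (M2), gap (G1) of planner qa-qnc0-p1's ROUND-21 §5.6–5.7):
# walk hardness on SUBCUBES — `AffBells22.WalkHardAllSubcube δ₀` for every `δ₀ < 1`, unconditionally
# (part 1/2: statement, the full-module tube bound, and the subcube enumeration; part 2 = `AffBells22WalkHardAllSubcube.lean`)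

qn-lit g24's answer to ask P-22h (HOME/qa-qnc0/INBOX 2026-08-28), kernel form.  The tube-rank proof of
`WalkHardAll` (`WalkTubeRank.tubePlan`: `tubeBound` + `tubeMass` + `binomTailLower`) consumes the strategy
only through `stratFun_mem_fullSpan` (the strategy's `𝔽₄`-function lies in the FULL module
`M_D(P) = Σ_g 𝔽₄[u]_{≤D}·χ_{a^{(g)}}`, all `g`, arbitrary `𝔽₄` coefficients) and `tr_stratFun`
(`tr f = [WIN]` pointwise); nothing refers to the charge sequence or to which cut uses which path pattern.
Restricting the walk game to a subcube `{u_W = a_W}` keeps the strategy's function inside the full module OF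
THE FREE CUBE: along the increasing enumeration `emb : Fin (n − |W|) → Wᶜ` a path pattern restricts to a
path pattern (`aPat g ∘ emb = aPat (cut g)`, `cut g = #{free i < g}`), its character to a constant times
the free path character (`chi_ext`), and cut tables of `𝔽₂`-degree `≤ D` in the free bits stay of degree
`≤ D` (`comp_mem_lowDeg_of_coord`).  Hence:

* `failSet_ge_of_mem_fullSpan` — the tube bound for the WHOLE full module at square-root degree:
  `∃ c > 0 ∃ m₀ ∀ m ≥ m₀ ∀ D ≤ ⌊√m⌋ ∀ f ∈ M_D(P_m), #FAIL(f) ≥ c·2^m` (re-run of `tubePlan`);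
* `Subcube.card_win_ext_le` — on every subcube, every walk strategy whose cut tables are degree-`≤ D`
  functions of the free bits (`D ≤ ⌊√(n − |W|)⌋`, `n − |W| ≥ m₀`) wins on at most `(1 − c)·2^{n−|W|}`
  free patterns;
* **`walkHardAllSubcube : δ₀ < 1 → WalkHardAllSubcube δ₀`** — the statement typed VERBATIM in
  `HOME/qa-qnc0-p1/exp22/Sketch22.lean` §2e (count over the full cube with multiplicity `2^{|W|}`), with
  the SAME `θ = 1 − c` as `WalkHardAll` and `n₀ = n₀(C, δ₀)` only.

WHAT THIS IS NOT: the ring-side (G1) `JuntaHardConditioned` needs in addition the odd-class transport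
`walkTransportF` run fibrewise in `a` (planner's `JuntaHardConditionedOfSubcube`); nothing on strategies that
read `W` with only a joint polylog-degree bound; separation NOT moved.
-/

noncomputable section

namespace Summit.QuantumAdvantage.AdviceFreeQNC0

open Classical
open Finset Literature.Computability.MetaComplexity Literature.Computability.MetaComplexity.Smolensky
open F4

namespace AffBells22

/-- overwrite the coordinates in `W` by `a` (the point of the subcube `{u_W = a_W}` above the free bits of
`u`). (Sketch22 §2e, verbatim.) -/
def subcubeMerge {n : ℕ} (W : Finset (Fin n)) (a u : Fin n → Bool) : Fin n → Bool :=
  fun i => if i ∈ W then a i else u i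

/-- **`WalkHardAllSubcube δ₀`** — `WalkHardAll` for the walk game restricted to any subcube `{u_W = a}`
with `|W| ≤ δ₀·n`: strategies whose outputs are polylog-degree `𝔽₂`-polynomials OF THE FREE BITS (arbitrary
dependence on `a`) win on at most a `θ`-fraction of the subcube (counted over the full cube, i.e. with
multiplicity `2^{|W|}`). (Sketch22 §2e, verbatim.) -/
def WalkHardAllSubcube (δ₀ : ℝ) : Prop :=
  ∃ θ : ℝ, θ < 1 ∧ ∀ C : ℕ, ∃ n₀ : ℕ, ∀ n ≥ n₀, ∀ c : ℕ, ∀ (W : Finset (Fin n)) (a : Fin n → Bool),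
    (W.card : ℝ) ≤ δ₀ * n → ∀ y : Fin (n + 1) → (Fin n → Bool) → Bool,
      (∀ g, HasDeg (fun u => y g (subcubeMerge W a u)) ((Nat.log 2 n) ^ C)) →
        ((univ.filter fun u : Fin n → Bool => ringWinU c y (subcubeMerge W a u) = true).card : ℝ)
          ≤ θ * (2 : ℝ) ^ n

end AffBells22

open AffBells22

/-! ### 1. The tube bound for the whole full module at square-root degree -/

/-- **The full module fails on a constant fraction**: with `C₁, m₀` from `tubeMass` and `c, m₁` from
`binomTailLower (C₁ + 1)`: for `m ≥ max(m₀, m₁, 4(C₁+1)²)`, every `D ≤ ⌊√m⌋` and every `f ∈ M_D(P_m)`,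
`#FAIL(f) ≥ (c/2)·2^m` (`D' = m/2 − C₁⌊√m⌋ − D`; `tubeBound`).  The assembly of `tubePlan`, with the
strategy replaced by an arbitrary element of the full module. -/
theorem failSet_ge_of_mem_fullSpan :
    ∃ c : ℝ, 0 < c ∧ ∃ m₀ : ℕ, ∀ m ≥ m₀, ∀ D : ℕ, D ≤ Nat.sqrt m →
      ∀ f : (Fin m → Bool) → F4, f ∈ fullSpan m D → c * (2 : ℝ) ^ m ≤ ((failSetOf f).card : ℝ) := by
  obtain ⟨C₁, m₀, hmass⟩ := tubeMass
  obtain ⟨c, hc, m₁, htail⟩ := binomTailLower (C₁ + 1)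
  refine ⟨c / 2, by linarith, max (max m₀ m₁) (4 * (C₁ + 1) ^ 2), fun m hm D hD f hf => ?_⟩
  have hm₀ : m₀ ≤ m := le_trans (le_trans (le_max_left _ _) (le_max_left _ _)) hm
  have hm₁ : m₁ ≤ m := le_trans (le_trans (le_max_right _ _) (le_max_left _ _)) hm
  have hbig : 4 * (C₁ + 1) ^ 2 ≤ m := le_trans (le_max_right _ _) hm
  set s := Nat.sqrt m with hs
  have hs2 : 2 * (C₁ + 1) ≤ s := by
    rw [hs, Nat.le_sqrt]
    nlinarith
  have hss : s * s ≤ m := Nat.sqrt_le m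
  have hfit2 : 2 * (D + C₁ * s) ≤ m := by nlinarith
  have hfit : D + C₁ * s ≤ m / 2 := by omega
  set D' := m / 2 - C₁ * s - D with hD'
  have hsum : D' + D = m / 2 - C₁ * s := by omega
  have ht : m / 2 - (C₁ * s + D) = D' := by omega
  have htle : C₁ * s + D ≤ (C₁ + 1) * s := by nlinarith
  have h₃ := tubeBound m D D' f hf
  rw [hsum] at h₃
  have h₄ := hmass m hm₀
  have h₅ := htail m hm₁ (C₁ * s + D) htle
  rw [ht] at h₅
  set FAR := (farSet m (m / 2 - C₁ * s)).card with hFAR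
  set N := numMonomials m D' with hN
  set FAIL := (failSetOf f).card with hFAIL
  have h2m : (0 : ℝ) < (2 : ℝ) ^ m := by positivity
  have h₃R : (FAR : ℝ) * N ≤ (2 : ℝ) ^ m * FAIL := by exact_mod_cast h₃
  have h₄R : (2 : ℝ) ^ m ≤ 2 * FAR := by exact_mod_cast h₄
  have step1 : (2 : ℝ) ^ m / 2 * (c * (2 : ℝ) ^ m) ≤ (FAR : ℝ) * N :=
    mul_le_mul (by linarith) h₅ (by positivity) (Nat.cast_nonneg _)
  have step2 : (2 : ℝ) ^ m * (c / 2 * (2 : ℝ) ^ m) ≤ (2 : ℝ) ^ m * FAIL := by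
    calc (2 : ℝ) ^ m * (c / 2 * (2 : ℝ) ^ m) = (2 : ℝ) ^ m / 2 * (c * (2 : ℝ) ^ m) := by ring
      _ ≤ (FAR : ℝ) * N := step1
      _ ≤ (2 : ℝ) ^ m * FAIL := h₃R
  exact le_of_mul_le_mul_left step2 h2m

/-! ### 2. Subcubes: free coordinates, extension, restriction of path characters -/

namespace Subcube

variable {n : ℕ} (W : Finset (Fin n)) (a : Fin n → Bool)

/-- `|Wᶜ| = n − |W|`. -/
theorem card_compl_eq : (Wᶜ).card = n - W.card := by
  rw [Finset.card_compl, Fintype.card_fin]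

/-- The increasing enumeration of the free coordinates `Wᶜ`. -/
def iso : Fin (n - W.card) ≃o {i // i ∈ Wᶜ} := (Wᶜ).orderIsoOfFin (card_compl_eq W)

/-- The `j`-th free coordinate. -/
def emb (j : Fin (n - W.card)) : Fin n := (iso W j : Fin n)

/-- The enumeration of the free coordinates avoids `W`. -/
theorem emb_not_mem (j : Fin (n - W.card)) : emb W j ∉ W :=
  Finset.mem_compl.1 (iso W j).2

/-- The enumeration of the free coordinates is increasing. -/
theorem emb_strictMono : StrictMono (emb W) := fun _ _ h => (iso W).strictMono h

/-- The index of a free coordinate. -/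
def idx (i : Fin n) (h : i ∉ W) : Fin (n - W.card) := (iso W).symm ⟨i, Finset.mem_compl.2 h⟩

/-- `emb ∘ idx = id` on the free coordinates. -/
theorem emb_idx (i : Fin n) (h : i ∉ W) : emb W (idx W i h) = i := by
  unfold emb idx
  rw [OrderIso.apply_symm_apply]

/-- `idx ∘ emb = id`. -/
theorem idx_emb (j : Fin (n - W.card)) : idx W (emb W j) (emb_not_mem W j) = j := by
  unfold idx emb
  simp

/-- Extension of free bits `v` by `a` on `W`. -/
def ext (v : Fin (n - W.card) → Bool) : Fin n → Bool :=
  fun i => if h : i ∈ W then a i else v (idx W i h)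

/-- Restriction to the free coordinates. -/
def res {β : Type*} (u : Fin n → β) : Fin (n - W.card) → β := fun j => u (emb W j)

/-- On `W` the extended vector is `a`. -/
theorem ext_of_mem (v : Fin (n - W.card) → Bool) {i : Fin n} (h : i ∈ W) : ext W a v i = a i := by
  unfold ext; rw [dif_pos h]

/-- On the free coordinates the extended vector is `v`. -/
theorem ext_emb (v : Fin (n - W.card) → Bool) (j : Fin (n - W.card)) : ext W a v (emb W j) = v j := by
  unfold ext
  rw [dif_neg (emb_not_mem W j), idx_emb]

/-- Restricting an extension gives back the free vector. -/
theorem res_ext (v : Fin (n - W.card) → Bool) : res W (ext W a v) = v := by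
  funext j; exact ext_emb W a v j

/-- The subcube point of `u` is the extension of its restriction. -/
theorem merge_eq_ext_res (u : Fin n → Bool) : subcubeMerge W a u = ext W a (res W u) := by
  funext i
  unfold subcubeMerge ext res
  by_cases h : i ∈ W
  · rw [if_pos h, dif_pos h]
  · rw [if_neg h, dif_neg h, emb_idx]

/-- Extensions are fixed by the subcube merge. -/
theorem merge_ext (v : Fin (n - W.card) → Bool) : subcubeMerge W a (ext W a v) = ext W a v := by
  rw [merge_eq_ext_res, res_ext]

/-- Number of free coordinates below `g`. -/
def cut (g : ℕ) : ℕ := (univ.filter fun j : Fin (n - W.card) => (emb W j).val < g).card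

/-- The free coordinates below `g` form the initial segment of length `cut g`. -/
theorem emb_lt_iff (g : ℕ) (j : Fin (n - W.card)) : (emb W j).val < g ↔ j.val < cut W g := by
  constructor
  · intro hj
    have hsub : Finset.Iic j ⊆ univ.filter (fun j' : Fin (n - W.card) => (emb W j').val < g) := by
      intro j' hj'
      rw [Finset.mem_Iic] at hj'
      rw [mem_filter]
      refine ⟨mem_univ _, lt_of_le_of_lt ?_ hj⟩
      exact Fin.le_iff_val_le_val.mp ((emb_strictMono W).monotone hj')
    have h := card_le_card hsub
    rw [Fin.card_Iic] at h
    unfold cut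
    omega
  · intro hj
    by_contra hge
    push Not at hge
    have hsub : univ.filter (fun j' : Fin (n - W.card) => (emb W j').val < g) ⊆ Finset.Iio j := by
      intro j' hj'
      rw [mem_filter] at hj'
      rw [Finset.mem_Iio]
      by_contra hle
      push Not at hle
      have h1 : (emb W j).val ≤ (emb W j').val :=
        Fin.le_iff_val_le_val.mp ((emb_strictMono W).monotone hle)
      omega
    have h := card_le_card hsub
    rw [Fin.card_Iio] at h
    unfold cut at hj
    omega

/-- **Path patterns restrict to path patterns**: `a^{(g)} ∘ emb = a^{(cut g)}`. -/
theorem res_aPat (g : ℕ) : res W (aPat g : Fin n → Bool) = aPat (cut W g) := by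
  funext j
  unfold res aPat
  rw [decide_eq_decide]
  exact emb_lt_iff W g j

/-- A character at an extended point: the `W`-part is a constant, the free part is the character of
the restricted pattern. -/
theorem chi_ext (b : Fin n → Bool) (v : Fin (n - W.card) → Bool) :
    chi b (ext W a v) = (∏ i ∈ W, (if a i then ω ^ lett (b i) else 1)) * chi (res W b) v := by
  unfold chi
  rw [← Finset.prod_mul_prod_compl W (fun i => if ext W a v i = true then ω ^ lett (b i) else 1)]
  congr 1
  · refine prod_congr rfl fun i hi => ?_
    rw [ext_of_mem W a v hi]
  · have hmap : (Wᶜ : Finset (Fin n)) = univ.map ((Wᶜ).orderEmbOfFin (card_compl_eq W)).toEmbedding :=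
      (Finset.map_orderEmbOfFin_univ _ _).symm
    rw [hmap, Finset.prod_map]
    refine prod_congr rfl fun j _ => ?_
    have e : ((Wᶜ).orderEmbOfFin (card_compl_eq W)).toEmbedding j = emb W j := rfl
    rw [e, ext_emb]
    rfl

/-- **Path characters restrict to constants times path characters.** -/
theorem chi_aPat_ext (g : ℕ) (v : Fin (n - W.card) → Bool) :
    chi (aPat g) (ext W a v)
      = (∏ i ∈ W, (if a i then ω ^ lett ((aPat g : Fin n → Bool) i) else 1)) * chi (aPat (cut W g)) v := by
  rw [chi_ext, res_aPat]

/-- **Degree does not grow**: a degree-`≤ D` function of the merged point is, as a function of the free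
bits, of degree `≤ D` (`comp_mem_lowDeg_of_coord`: every coordinate of `ext` is a constant or a variable). -/
theorem hasDeg_comp_ext {D : ℕ} {h : (Fin n → Bool) → Bool} (hh : HasDeg h D) :
    HasDeg (fun v => h (ext W a v)) D := by
  unfold HasDeg at hh ⊢
  refine comp_mem_lowDeg_of_coord (F := ZMod 2) (ext W a) (fun i => ?_) hh
  by_cases hi : i ∈ W
  · by_cases ha : a i = true
    · have e : (fun u : Fin (n - W.card) → Bool => if ext W a u i = true then (1 : ZMod 2) else 0)
          = mono (ZMod 2) (∅ : Finset (Fin (n - W.card))) := by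
        funext u; rw [ext_of_mem W a u hi, if_pos ha, mono_empty]; rfl
      rw [e]; exact mono_mem_lowDeg (by simp)
    · have e : (fun u : Fin (n - W.card) → Bool => if ext W a u i = true then (1 : ZMod 2) else 0) = 0 := by
        funext u; rw [ext_of_mem W a u hi, if_neg ha]; rfl
      rw [e]; exact Submodule.zero_mem _
  · have e : (fun u : Fin (n - W.card) → Bool => if ext W a u i = true then (1 : ZMod 2) else 0)
        = mono (ZMod 2) ({idx W i hi} : Finset (Fin (n - W.card))) := by
      funext u
      rw [mono_apply]
      simp only [Finset.mem_singleton, forall_eq]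
      unfold ext
      rw [dif_neg hi]
    rw [e]; exact mono_mem_lowDeg (by simp)

end Subcube

end Summit.QuantumAdvantage.AdviceFreeQNC0

end
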